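import Literature.NumberTheory.NumberFields.HerbrandStickelbergerAvatar
import Mathlib.RingTheory.Polynomial.Eisenstein.IsIntegral
import Mathlib.RingTheory.Polynomial.GaussLemma
import Mathlib.RingTheory.Polynomial.Cyclotomic.Roots
import Mathlib.NumberTheory.Padics.RingHoms
import Mathlib.Data.ZMod.Units
import HarnessLib

/-!
# The two typings of Mazur–Wiles 1984 Thm. 2 are EQUIVALENT: the converse bridge
# `thm2_card_oddChiClassGroup_eq_bernoulli → thm2_oddChiPart_classGroup_card_eq_pow_val_bernoulli`

Topic `Literature/NumberTheory/NumberFields`, namespace `Literature.NumberTheory.NumberFields`. THEOREMS ONLY (no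
definition, no named fact, no instance; net debt 0). Sequel of `ImaginaryAbelianFieldOddChiClassNumberBridge.lean`,
which proves `thm2_oddChiPart… → thm2_card…` between the tree's two statement-only typings of B. Mazur, A. Wiles,
*Class fields of abelian extensions of `ℚ`*, Invent. Math. 76 (1984), Thm. 2 (p. 216) (quoted by Solomon 1990,
pp. 467–468). This file proves the CONVERSE, so the two named facts are kernel-equivalent (one printed theorem, one
debt: a `_holds` for either typing discharges both). Typed for the ARM-P audit of cell bsd-cited (row Q153, target
T-Q153-1) at the disposal of the owning cell bsd-print-cfram.

Proof: the Frobenius-avatar dictionary `IsDirichletAvatar K θ χ m` gives the `Γ_ℚ`-pointwise dictionary (tree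
`HerbrandStickelberger.forall_absGaloisQuot_eq_of_isDirichletAvatar`); on a PRIMITIVE `ℚ_p`-valued `χ` of conductor
`f ≠ p` the Teichmüller congruence `‖χ(a) − a‖_p < 1` fails for some `a` prime to `p`
(`not_forall_norm_sub_lt_one_of_isPrimitive_of_ne`: `p ∤ f` is the tree's `not_forall_norm_sub_lt_one_of_not_dvd`;
`p ∣ f` with prime-to-`p` part `> 1` by a Chinese-remainder witness; `f = p^k`, `k ≥ 2` is impossible,
`not_isPrimitive_of_conductor_prime_pow`, since the kernel of `(ℤ/p^k)ˣ → (ℤ/p^{k−1})ˣ` has order `p` and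
`ζ_p ∉ ℚ_p` for odd `p` — `Φ_p(X+1)` Eisenstein, re-proved here on Mathlib after the tree's
`Literature.AnabelianGeometry.EtaleTheta.not_isRoot_cyclotomic_prime_padic` so as not to import that cone), so the
two «`χ ≠ ω`» clauses match; and `ℤ_p ⊗_ℤ Cl(K)` is FINITE (`finite_padicInt_tensor_of_finite`), so `#e_θ ≥ 1`,
`B_{1,χ⁻¹} ≠ 0`, `#e_θ = ‖B_{1,χ⁻¹}‖_p⁻¹ = p^n`; the Bernoulli normalisations agree by the tree's
`bernoulliOnePrim_inv_eq_generalizedBernoulli`. HONEST FRAMING: nothing here discharges either named fact; BSD is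
not proved by any of this.

## References

* [MazurWiles1984] B. Mazur, A. Wiles, Invent. Math. 76 (1984) 179–330, Thm. 2 (p. 216).
* [Solomon1990] D. Solomon, Ann. Inst. Fourier 40 (1990) 467–492, §I pp. 467–468, §II.2 p. 471.
* [Washington1997] L. C. Washington, *Introduction to Cyclotomic Fields*, 2nd ed., §3 (conductors), §5.1 (ω).
* [SerreLocalFields1979] J.-P. Serre, *Local Fields*, IV §4 Prop. 17 (`ℚ_p(ζ_p)/ℚ_p` totally ramified, degree `p−1`).
* [Serre1973] J.-P. Serre, *A Course in Arithmetic*, Ch. II §3.1 Prop. 7 (roots of unity of `ℚ_p`).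
-/
noncomputable section

open scoped TensorProduct

namespace Literature.NumberTheory.NumberFields

open _root_.NumberField

/-! ## §1 `ζ_p ∉ ℚ_p` for an odd prime `p` (`Φ_p(X+1)` is Eisenstein at `p`) -/

section RootsOfUnity

open Polynomial

variable (p : ℕ) [hp : Fact p.Prime]

omit hp in
/-- `Φ_p(X + 1) ∈ ℤ[X]` is monic. [folklore] -/
private theorem monic_cyclotomic_comp_X_add_one : ((cyclotomic p ℤ).comp (X + 1)).Monic := by
  rw [show (X + 1 : ℤ[X]) = X + C 1 by simp]
  refine (cyclotomic.monic _ ℤ).comp (monic_X_add_C 1) fun h => ?_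
  rw [natDegree_X_add_C] at h
  exact zero_ne_one h.symm

/-- The degree of `Φ_p(X + 1)` is `p - 1`. [folklore] -/
private theorem natDegree_cyclotomic_comp_X_add_one :
    ((cyclotomic p ℤ).comp (X + 1)).natDegree = p - 1 := by
  rw [natDegree_comp, show (X + 1 : ℤ[X]) = X + C 1 by simp, natDegree_X_add_C, mul_one,
    natDegree_cyclotomic, Nat.totient_prime hp.out]

/-- `Φ_p(X+1)` is Eisenstein at the maximal ideal of `ℤ_p` (`Φ_p(1) = p ∉ (p²)`).
[cite: SerreLocalFields1979, IV §4 Prop 17] -/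
private theorem cyclotomic_comp_X_add_one_isEisensteinAt_padicInt :
    (((cyclotomic p ℤ).comp (X + 1)).map (Int.castRingHom ℤ_[p])).IsEisensteinAt
      (IsLocalRing.maximalIdeal ℤ_[p]) := by
  have hE : ((cyclotomic p ℤ).comp (X + 1)).IsEisensteinAt (Submodule.span ℤ {(p : ℤ)}) :=
    cyclotomic_comp_X_add_one_isEisensteinAt p
  have hmonic := (monic_cyclotomic_comp_X_add_one p).map (Int.castRingHom ℤ_[p])
  refine hmonic.isEisensteinAt_of_mem_of_notMem (IsLocalRing.maximalIdeal.isMaximal ℤ_[p]).ne_top ?_ ?_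
  · intro n hn
    have hw := (hE.isWeaklyEisensteinAt.map (Int.castRingHom ℤ_[p])).mem hn
    have hmap : Ideal.map (Int.castRingHom ℤ_[p]) (Submodule.span ℤ {(p : ℤ)}) =
        Ideal.span {(p : ℤ_[p])} := by
      rw [Ideal.submodule_span_eq, Ideal.map_span, Set.image_singleton, map_natCast]
    rw [PadicInt.maximalIdeal_eq_span_p, ← hmap]
    exact hw
  · rw [coeff_map, coeff_zero_eq_eval_zero, eval_comp, eval_add, eval_X, eval_one, zero_add,
      eval_one_cyclotomic_prime, map_natCast, PadicInt.maximalIdeal_eq_span_p,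
      Ideal.span_singleton_pow, Ideal.mem_span_singleton]
    rintro ⟨c, hc⟩
    have hp0 : (p : ℤ_[p]) ≠ 0 := by exact_mod_cast hp.out.ne_zero
    have h1 : (p : ℤ_[p]) * 1 = (p : ℤ_[p]) * (p * c) := by rw [mul_one, ← mul_assoc, ← sq]; exact hc
    have h2 : (1 : ℤ_[p]) = p * c := mul_left_cancel₀ hp0 h1
    exact (PadicInt.irreducible_p (p := p)).not_isUnit (isUnit_iff_exists_inv.2 ⟨c, h2.symm⟩)

/-- The base change to `ℚ_p` of `Φ_p(X+1) ∈ ℤ_p[X]` is `Φ_p(X+1) ∈ ℚ_p[X]`. [folklore] -/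
private theorem map_cyclotomic_comp_eq :
    (((cyclotomic p ℤ).comp (X + 1)).map (Int.castRingHom ℤ_[p])).map (algebraMap ℤ_[p] ℚ_[p]) =
      (cyclotomic p ℚ_[p]).comp (X + 1) := by
  rw [Polynomial.map_map, map_comp, Polynomial.map_add, map_X, Polynomial.map_one]
  congr 1
  have : (algebraMap ℤ_[p] ℚ_[p]).comp (Int.castRingHom ℤ_[p]) = Int.castRingHom ℚ_[p] :=
    RingHom.ext_int _ _
  rw [this, map_cyclotomic_int]

/-- `Φ_p(X+1)` is irreducible over `ℚ_p` (Eisenstein over `ℤ_p` + Gauss).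
[cite: SerreLocalFields1979, IV §4 Prop 17] -/
private theorem irreducible_cyclotomic_comp_padic :
    Irreducible ((cyclotomic p ℚ_[p]).comp (X + 1)) := by
  have hirr : Irreducible (((cyclotomic p ℤ).comp (X + 1)).map (Int.castRingHom ℤ_[p])) := by
    have hmonic := (monic_cyclotomic_comp_X_add_one p).map (Int.castRingHom ℤ_[p])
    refine (cyclotomic_comp_X_add_one_isEisensteinAt_padicInt p).irreducible
      (IsLocalRing.maximalIdeal.isMaximal ℤ_[p]).isPrime hmonic.isPrimitive ?_
    rw [(monic_cyclotomic_comp_X_add_one p).natDegree_map, natDegree_cyclotomic_comp_X_add_one]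
    have := hp.out.two_le
    omega
  rw [← map_cyclotomic_comp_eq]
  exact (((monic_cyclotomic_comp_X_add_one p).map
    (Int.castRingHom ℤ_[p])).irreducible_iff_irreducible_map_fraction_map (K := ℚ_[p])).1 hirr

/-- **For an odd prime `p`, `ℚ_p` contains no primitive `p`-th root of unity** (`Φ_p(X+1)` is Eisenstein
at `p`, so `Φ_p` is irreducible of degree `p − 1 ≥ 2` over `ℚ_p` and has no root there). Re-proved on
Mathlib's `cyclotomic_comp_X_add_one_isEisensteinAt` after the tree's
`Literature.AnabelianGeometry.EtaleTheta.not_isRoot_cyclotomic_prime_padic` (same argument; not imported, to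
keep the `NumberFields` cone free of the anabelian one); the same statement is also proved Summit-side as
`Summit.BirchSwinnertonDyer.BirchSwinnertonDyer.Theorems.TeichmullerTwistDescent.LocalPTorsion.not_isPrimitiveRoot_padic_self`
(not importable into `Literature/`).
[cite: SerreLocalFields1979, IV §4 Prop 17] [cite: Serre1973, Ch. II §3.1 Prop. 7] -/
theorem not_isPrimitiveRoot_prime_padic_of_ne_two (hp2 : p ≠ 2) (ζ : ℚ_[p]) :
    ¬ IsPrimitiveRoot ζ p := by
  intro hζ
  haveI : NeZero ((p : ℕ) : ℚ_[p]) := ⟨by exact_mod_cast hp.out.ne_zero⟩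
  have hx : IsRoot (cyclotomic p ℚ_[p]) ζ := (isRoot_cyclotomic_iff).2 hζ
  have hroot : IsRoot ((cyclotomic p ℚ_[p]).comp (X + 1)) (ζ - 1) := by
    rw [IsRoot, eval_comp, eval_add, eval_X, eval_one, sub_add_cancel]
    exact hx
  have h1 := degree_eq_one_of_irreducible_of_root (irreducible_cyclotomic_comp_padic p) hroot
  have hdeg : ((cyclotomic p ℚ_[p]).comp (X + 1)).natDegree = p - 1 := by
    rw [natDegree_comp, show (X + 1 : ℚ_[p][X]) = X + C 1 by simp, natDegree_X_add_C, mul_one,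
      natDegree_cyclotomic, Nat.totient_prime hp.out]
  have h2 : ((cyclotomic p ℚ_[p]).comp (X + 1)).natDegree = 1 := natDegree_eq_of_degree_eq_some h1
  have h3 := hp.out.two_le
  omega

end RootsOfUnity

/-! ## §2 No primitive `ℚ_p`-valued Dirichlet character of conductor `p^k`, `k ≥ 2` (`p` odd) -/

section Conductor

variable {p : ℕ} [hp : Fact p.Prime]

/-- The kernel of `(ℤ/p^{k+2})ˣ → (ℤ/p^{k+1})ˣ` has order `p` (`φ(p^{k+2}) = p · φ(p^{k+1})`, the map is
onto), so each of its elements satisfies `u^p = 1`. [folklore]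
[cite: Washington1997, §5.1 (structure of (ℤ/p^n)ˣ)] -/
private theorem pow_prime_eq_one_of_unitsMap_eq_one (k : ℕ) (u : (ZMod (p ^ (k + 2)))ˣ)
    (hu : ZMod.unitsMap (pow_dvd_pow p (Nat.le_succ (k + 1))) u = 1) : u ^ p = 1 := by
  haveI : NeZero (p ^ (k + 2)) := ⟨pow_ne_zero _ hp.out.ne_zero⟩
  haveI : NeZero (p ^ (k + 1)) := ⟨pow_ne_zero _ hp.out.ne_zero⟩
  set φ : (ZMod (p ^ (k + 2)))ˣ →* (ZMod (p ^ (k + 1)))ˣ :=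
    ZMod.unitsMap (pow_dvd_pow p (Nat.le_succ (k + 1))) with hφ
  have hG : Nat.card (ZMod (p ^ (k + 2)))ˣ = p ^ (k + 1) * (p - 1) := by
    rw [Nat.card_eq_fintype_card, ZMod.card_units_eq_totient, Nat.totient_prime_pow_succ hp.out]
  have hidx : φ.ker.index = p ^ k * (p - 1) := by
    rw [Subgroup.index_ker, MonoidHom.range_eq_top.mpr (ZMod.unitsMap_surjective _), Subgroup.card_top,
      Nat.card_eq_fintype_card, ZMod.card_units_eq_totient, Nat.totient_prime_pow_succ hp.out]
  have hker : Nat.card φ.ker = p := by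
    have h := Subgroup.card_mul_index φ.ker
    rw [hidx, hG] at h
    have hpos : 0 < p ^ k * (p - 1) := Nat.mul_pos (pow_pos hp.out.pos _) (by have := hp.out.two_le; omega)
    exact Nat.eq_of_mul_eq_mul_right hpos (by rw [h]; ring)
  have hmem : u ∈ φ.ker := by rw [MonoidHom.mem_ker]; exact hu
  have hpow : (⟨u, hmem⟩ : φ.ker) ^ Nat.card φ.ker = 1 := pow_card_eq_one'
  rw [hker] at hpow
  exact congrArg Subtype.val hpow

/-- **For an odd prime `p` there is no primitive `ℚ_p`-valued Dirichlet character of conductor `p^k`, `k ≥ 2`**: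
it would be non-trivial on the kernel of `(ℤ/p^k)ˣ → (ℤ/p^{k−1})ˣ` (else it factors through level `p^{k−1}`,
Mathlib `DirichletCharacter.factorsThrough_iff_ker_unitsMap`), a group of exponent `p`, so one of its values
would be a primitive `p`-th root of unity of `ℚ_p` (`not_isPrimitiveRoot_prime_padic_of_ne_two`).
[cite: Washington1997, §3 (conductor of a Dirichlet character), §5.1] [cite: Serre1973, Ch. II §3.1 Prop. 7] -/
theorem not_isPrimitive_of_conductor_prime_pow (hp2 : p ≠ 2) (k : ℕ)
    (χ : DirichletCharacter ℚ_[p] (p ^ (k + 2))) : ¬ χ.IsPrimitive := by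
  haveI : NeZero (p ^ (k + 2)) := ⟨pow_ne_zero _ hp.out.ne_zero⟩
  intro hprim
  have hd : p ^ (k + 1) ∣ p ^ (k + 2) := pow_dvd_pow p (Nat.le_succ (k + 1))
  -- `χ` does not factor through the level `p^(k+1)`
  have hnf : ¬ χ.FactorsThrough (p ^ (k + 1)) := by
    intro hf
    have hle : χ.conductor ≤ p ^ (k + 1) :=
      Nat.sInf_le ((DirichletCharacter.mem_conductorSet_iff χ).mpr hf)
    rw [hprim] at hle
    have hlt : p ^ (k + 1) < p ^ (k + 2) := Nat.pow_lt_pow_right hp.out.one_lt (by omega)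
    omega
  rw [DirichletCharacter.factorsThrough_iff_ker_unitsMap hd, SetLike.le_def] at hnf
  push Not at hnf
  obtain ⟨u, hu, hχu⟩ := hnf
  rw [MonoidHom.mem_ker] at hu hχu
  have hup : u ^ p = 1 := pow_prime_eq_one_of_unitsMap_eq_one k u hu
  -- the value `ζ = χ(u)` is a primitive `p`-th root of unity in `ℚ_p`
  set ζ : ℚ_[p]ˣ := MulChar.toUnitHom χ u with hζ
  have hζp : ζ ^ p = 1 := by rw [hζ, ← map_pow, hup, map_one]
  have hord : orderOf ζ = p := orderOf_eq_prime hζp hχu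
  have hprimζ : IsPrimitiveRoot ζ p := by
    have h := IsPrimitiveRoot.orderOf ζ
    rwa [hord] at h
  exact not_isPrimitiveRoot_prime_padic_of_ne_two p hp2 (ζ : ℚ_[p])
    (IsPrimitiveRoot.coe_units_iff.mpr hprimζ)

/-- **The «`χ ≠ ω`» clause of the first typing from that of the second.** For `p` odd and a PRIMITIVE
`ℚ_p`-valued Dirichlet character `χ` mod `f ≠ p`, the Teichmüller congruence `‖χ(a) − a‖_p < 1` fails for some
`a` prime to `p`: `p ∤ f` is the tree's `not_forall_norm_sub_lt_one_of_not_dvd`; if `p ∣ f` with prime-to-`p`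
part `m > 1`, the Chinese-remainder witness `a ≡ 0 (mod m)`, `a ≡ 1 (mod p)` has `χ(a) = 0`, `‖a‖_p = 1`; and
`f = p^k`, `k ≥ 2` cannot occur (`not_isPrimitive_of_conductor_prime_pow`). (`ω` has conductor `p`.)
[cite: Solomon1990, §I p. 468 ("χ ≠ ω (the Teichmüller character)")] [cite: Washington1997, §5.1 (ω(a) ≡ a mod p)] -/
theorem not_forall_norm_sub_lt_one_of_isPrimitive_of_ne (hp2 : p ≠ 2) {f : ℕ} [NeZero f]
    {χ : DirichletCharacter ℚ_[p] f} (hprim : χ.IsPrimitive) (hfp : f ≠ p) :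
    ¬ ∀ a : ℤ, ¬ ((p : ℤ) ∣ a) → ‖χ (a : ZMod f) - (a : ℚ_[p])‖ < 1 := by
  by_cases hpf : p ∣ f
  swap
  · exact not_forall_norm_sub_lt_one_of_not_dvd hp2 χ hpf
  intro H
  obtain ⟨k, m, hpm, hf⟩ := Nat.exists_eq_pow_mul_and_not_dvd (NeZero.ne f) p hp.out.one_lt.ne'
  have hm0 : m ≠ 0 := by
    rintro rfl
    rw [mul_zero] at hf
    exact NeZero.ne f hf
  by_cases hm : m = 1
  · -- `f = p^k`: `k = 0` contradicts `p ∣ f`, `k = 1` contradicts `f ≠ p`, `k ≥ 2` is impossible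
    subst hm
    rw [mul_one] at hf
    rcases k with _ | _ | j
    · rw [pow_zero] at hf
      rw [hf] at hpf
      exact hp.out.one_lt.ne' (Nat.dvd_one.mp hpf)
    · rw [zero_add, pow_one] at hf
      exact hfp hf
    · subst hf
      exact not_isPrimitive_of_conductor_prime_pow hp2 j χ hprim
  · -- the Chinese-remainder witness
    have hcop : Nat.Coprime m p :=
      (Nat.coprime_comm.mp ((Nat.Prime.coprime_iff_not_dvd hp.out).mpr hpm))
    obtain ⟨a, ham, hap⟩ := Nat.chineseRemainder hcop 0 1
    -- `p ∤ a`
    have hpa : ¬ ((p : ℤ) ∣ (a : ℤ)) := by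
      intro hdvd
      have hdvd' : p ∣ a := by exact_mod_cast hdvd
      have h1 : a % p = 1 := by
        rw [hap]; exact Nat.mod_eq_of_lt hp.out.one_lt
      rw [Nat.mod_eq_zero_of_dvd hdvd'] at h1
      exact zero_ne_one h1
    -- `χ(a) = 0`: `a` is not a unit mod `f` (`m ∣ gcd(a, f)`, `m > 1`)
    have hma : m ∣ a := (Nat.modEq_zero_iff_dvd.mp ham)
    have hmf : m ∣ f := ⟨p ^ k, by rw [hf, mul_comm]⟩
    have hnu : ¬ IsUnit ((a : ℕ) : ZMod f) := by
      rw [ZMod.isUnit_iff_coprime]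
      intro hco
      have h1 : m ∣ Nat.gcd a f := Nat.dvd_gcd hma hmf
      rw [hco] at h1
      exact hm (Nat.dvd_one.mp h1)
    have hχa : χ ((a : ℤ) : ZMod f) = 0 := by
      rw [Int.cast_natCast]
      exact χ.map_nonunit hnu
    have hlt := H a hpa
    rw [hχa, zero_sub, norm_neg, Padic.norm_intCast_lt_one_iff] at hlt
    exact hpa hlt

end Conductor

/-! ## §3 `ℤ_p ⊗_ℤ A` is finite for a finite abelian group `A` -/

section Finite

variable {p : ℕ} [hp : Fact p.Prime]

/-- **`ℤ_p ⊗_ℤ A` is finite for a finite abelian group `A`**: the map `a ↦ 1 ⊗ a` is onto. Indeed with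
`N = #A = p^k · u`, `p ∤ u`, and `r ∈ ℤ_p` written `r = c + p^k s` with `c ∈ ℕ` (`PadicInt.appr`),
`r ⊗ a = 1 ⊗ (c·a) + (s u⁻¹) ⊗ (N·a) = 1 ⊗ (c·a)`. (So `ℤ_p ⊗ Cl(K)` is finite and `#e_θ(ℤ_p ⊗ Cl K) ≥ 1`.)
[folklore] [cite: Solomon1990, §II.1 (Cℓ(K) ⊗ 𝒪, a finite 𝒪-module)] -/
theorem finite_padicInt_tensor_of_finite (A : Type*) [AddCommGroup A] [Finite A] :
    Finite (ℤ_[p] ⊗[ℤ] A) := by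
  classical
  set N : ℕ := Nat.card A with hN
  have hN0 : N ≠ 0 := Nat.card_pos.ne'
  have hkill : ∀ a : A, (N : ℤ) • a = 0 := fun a => by
    rw [natCast_zsmul]
    exact addOrderOf_dvd_iff_nsmul_eq_zero.mp (addOrderOf_dvd_natCard a)
  obtain ⟨k, u, hpu, hNku⟩ := Nat.exists_eq_pow_mul_and_not_dvd hN0 p hp.out.one_lt.ne'
  -- `u` is a unit of `ℤ_p`
  have hu : IsUnit (u : ℤ_[p]) := by
    rw [PadicInt.isUnit_iff]
    have hle := PadicInt.norm_le_one (u : ℤ_[p])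
    have hnlt : ¬ ‖(u : ℤ_[p])‖ < 1 := by
      rw [← Int.cast_natCast, PadicInt.norm_int_lt_one_iff_dvd]
      exact_mod_cast hpu
    exact le_antisymm hle (not_lt.mp hnlt)
  obtain ⟨v, hv⟩ := hu
  -- `p^k r ⊗ a = 0`
  have key : ∀ (r : ℤ_[p]) (a : A), ((p : ℤ_[p]) ^ k * r) ⊗ₜ[ℤ] a = 0 := by
    intro r a
    have hN' : ((N : ℤ) : ℤ_[p]) = (p : ℤ_[p]) ^ k * (v : ℤ_[p]) := by
      rw [hv, hNku]; push_cast; ring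
    have hr : (p : ℤ_[p]) ^ k * r = (r * (v⁻¹ : ℤ_[p]ˣ)) * ((N : ℤ) : ℤ_[p]) := by
      rw [hN']
      calc (p : ℤ_[p]) ^ k * r = (p : ℤ_[p]) ^ k * r * (((v⁻¹ : ℤ_[p]ˣ) : ℤ_[p]) * v) := by
            rw [Units.inv_mul, mul_one]
        _ = (r * (v⁻¹ : ℤ_[p]ˣ)) * ((p : ℤ_[p]) ^ k * (v : ℤ_[p])) := by ring
    have hNa : (((N : ℤ) : ℤ_[p])) ⊗ₜ[ℤ] a = 0 := by
      rw [← Int.smul_one_eq_cast, TensorProduct.smul_tmul, hkill a, TensorProduct.tmul_zero]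
    have hsm : ((r * ((v⁻¹ : ℤ_[p]ˣ) : ℤ_[p])) * ((N : ℤ) : ℤ_[p])) ⊗ₜ[ℤ] a =
        (r * ((v⁻¹ : ℤ_[p]ˣ) : ℤ_[p])) • ((((N : ℤ) : ℤ_[p])) ⊗ₜ[ℤ] a) := by
      rw [TensorProduct.smul_tmul', smul_eq_mul]
    rw [hr, hsm, hNa, smul_zero]
  -- `a ↦ 1 ⊗ a` is onto
  let ι : A →+ ℤ_[p] ⊗[ℤ] A := (TensorProduct.mk ℤ ℤ_[p] A 1).toAddMonoidHom
  refine Finite.of_surjective ι fun t => ?_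
  induction t using TensorProduct.induction_on with
  | zero => exact ⟨0, map_zero ι⟩
  | tmul r a =>
      obtain ⟨s, hs⟩ : ∃ s, r - (PadicInt.appr r k : ℤ_[p]) = (p : ℤ_[p]) ^ k * s :=
        Ideal.mem_span_singleton.mp (PadicInt.appr_spec k r)
      generalize PadicInt.appr r k = c at hs
      refine ⟨(c : ℤ) • a, ?_⟩
      change (1 : ℤ_[p]) ⊗ₜ[ℤ] ((c : ℤ) • a) = r ⊗ₜ[ℤ] a
      have hr : r = ((c : ℤ) : ℤ_[p]) + (p : ℤ_[p]) ^ k * s := by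
        rw [Int.cast_natCast, ← hs]; ring
      rw [hr, TensorProduct.add_tmul, key, add_zero, ← Int.smul_one_eq_cast, TensorProduct.smul_tmul]
  | add x y hx hy =>
      obtain ⟨a, ha⟩ := hx
      obtain ⟨b, hb⟩ := hy
      exact ⟨a + b, by rw [map_add, ha, hb]⟩

end Finite

/-! ## §4 The converse bridge: the first typing implies the second -/

section Bridge

open Literature.NumberTheory.LFunctions Literature.NumberTheory.EllipticCurves

/-- **The first typing implies the second.** `MazurWiles1984.thm2_card_oddChiClassGroup_eq_bernoulli`
(`Γ_ℚ`-pointwise dictionary, conclusion `#e_ψ(ℤ_p ⊗ Cl K) = ‖B_{1,χ⁻¹}‖_p⁻¹`) ⟹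
`MazurWiles1984.thm2_oddChiPart_classGroup_card_eq_pow_val_bernoulli` (Frobenius-avatar dictionary, conclusion
`#e_θ = p^n ∧ ‖B_{1,χ⁻¹}‖_p = p^{−n}`): avatar ⟹ pointwise dictionary
(`HerbrandStickelberger.forall_absGaloisQuot_eq_of_isDirichletAvatar`); the «`χ ≠ ω`» clauses match on primitive `χ`
(`not_forall_norm_sub_lt_one_of_isPrimitive_of_ne`); `ℤ_p ⊗ Cl(K)` finite ⟹ `#e_θ ≥ 1` ⟹ `B_{1,χ⁻¹} ≠ 0`,
`‖B_{1,χ⁻¹}‖_p⁻¹ = p^v`, `v ≥ 0`; normalisations by `bernoulliOnePrim_inv_eq_generalizedBernoulli`. With the tree's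
`…_of_thm2_oddChiPart` the two named facts are EQUIVALENT. [cite: MazurWiles1984, Thm. 2 (p. 216) — via Solomon1990, §I p. 468] -/
theorem MazurWiles1984.thm2_oddChiPart_classGroup_card_eq_pow_val_bernoulli_of_thm2_card
    (h : MazurWiles1984.thm2_card_oddChiClassGroup_eq_bernoulli) :
    MazurWiles1984.thm2_oddChiPart_classGroup_card_eq_pow_val_bernoulli := by
  intro p _ hp2 K _ _ _ hpK θ f _ χ m hprim hθχ hodd hω
  have hψχ := HerbrandStickelberger.forall_absGaloisQuot_eq_of_isDirichletAvatar θ χ m hθχ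
  have hχω : ¬ ∀ a : ℤ, ¬ ((p : ℤ) ∣ a) → ‖χ (a : ZMod f) - (a : ℚ_[p])‖ < 1 := by
    by_cases hfp : f = p
    · exact fun H => hω ⟨hfp, H⟩
    · exact not_forall_norm_sub_lt_one_of_isPrimitive_of_ne hp2 hprim hfp
  have hcard := h p hp2 K hpK f χ hprim hodd hχω θ hψχ
  -- `ℤ_p ⊗ Cl(K)` is finite, so the `θ`-component has positive finite order
  haveI : Finite (ℤ_[p] ⊗[ℤ] Additive (ClassGroup (𝓞 K))) := finite_padicInt_tensor_of_finite _
  have hpos : 0 < classGroupChiCard ℚ K p (fun g => ((θ g : ℤ_[p]ˣ) : ℤ_[p])) := Nat.card_pos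
  rw [bernoulliOnePrim_inv_eq_generalizedBernoulli hprim] at hcard
  have hB0 : (generalizedBernoulli 1 χ⁻¹ : ℚ_[p]) ≠ 0 := by
    intro h0
    rw [h0, norm_zero, inv_zero] at hcard
    exact hpos.ne' (by exact_mod_cast hcard)
  have hp1 : (1 : ℝ) < p := by exact_mod_cast (Fact.out : p.Prime).one_lt
  have hnorm : ‖(generalizedBernoulli 1 χ⁻¹ : ℚ_[p])‖ =
      (p : ℝ) ^ (-(generalizedBernoulli 1 χ⁻¹ : ℚ_[p]).valuation) :=
    Padic.norm_eq_zpow_neg_valuation hB0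
  rw [hnorm, zpow_neg, inv_inv] at hcard
  have hv : 0 ≤ (generalizedBernoulli 1 χ⁻¹ : ℚ_[p]).valuation := by
    by_contra hneg
    have hlt : (p : ℝ) ^ (generalizedBernoulli 1 χ⁻¹ : ℚ_[p]).valuation < 1 :=
      zpow_lt_one_of_neg₀ hp1 (lt_of_not_ge hneg)
    rw [← hcard] at hlt
    have h1 : (1 : ℝ) ≤ classGroupChiCard ℚ K p (fun g => ((θ g : ℤ_[p]ˣ) : ℤ_[p])) := by
      exact_mod_cast hpos
    linarith
  obtain ⟨n, hn⟩ := Int.eq_ofNat_of_zero_le hv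
  refine ⟨n, ?_, ?_⟩
  · rw [hn, zpow_natCast] at hcard
    exact_mod_cast hcard
  · rw [hnorm, hn]

/-- **The two typings of Mazur–Wiles Thm. 2 are equivalent.** [cite: MazurWiles1984, Thm. 2 (p. 216) — via Solomon1990, §I p. 468] -/
theorem MazurWiles1984.thm2_oddChiPart_iff_thm2_card :
    MazurWiles1984.thm2_oddChiPart_classGroup_card_eq_pow_val_bernoulli ↔
      MazurWiles1984.thm2_card_oddChiClassGroup_eq_bernoulli :=
  ⟨MazurWiles1984.thm2_card_oddChiClassGroup_eq_bernoulli_of_thm2_oddChiPart,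
    MazurWiles1984.thm2_oddChiPart_classGroup_card_eq_pow_val_bernoulli_of_thm2_card⟩

end Bridge

end Literature.NumberTheory.NumberFields

end
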